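import Literature.MathematicalPhysics.QuantumFieldTheory.Balaban1983to89.B9Cor36GCubeLocLetter
import Literature.MathematicalPhysics.QuantumFieldTheory.Balaban1983to89.B9Cor36CubeCutoffs
import Literature.MathematicalPhysics.QuantumFieldTheory.Balaban1983to89.B9DeltaALocalReadingsInCollarY

/-!
# `Balaban1983to89.B9Cor36GCubeCutoffsB` — THE LOCALISED BOND-SECTOR CUBE LETTER `O_□ = χ_□·R(u)⁻¹G_□(Ṽ_□)R(u)·χ_□` AT THE CUT-OFFS OF RECORD: the five row data of
# G-F2's `B9Cor36GCubeLocLetter.localInverse_defect_laws_hTY` (`χ = 1` on the input stencils of the `h_□`-rows ∕ of `D^B_□`, the row set `D^B_□`, and the row agreement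
# `Δ_loc(U^u) = Δ_loc(Ṽ_□)` on the `h_□`-rows ∕ on `D^B_□`) DISCHARGED at `χ_□ := chiY`, `Ṽ_□ := locCfgY`, `parB := parBY` from the (3.35) datum of ONE class cube —
# [B9] Cor. 3.6 ∕ Sect. C p. 410 «G_□ depends on U restricted to Ω₀(□) ⊂ □̃⁵» for `G_□ = Δ_{a,□}⁻¹` in the cell's (R)-design (sub-row G-B9-LETTERS, module M5.1b-G, FILE G-F3)

T. Bałaban, *Propagators for lattice gauge theories in a background field*, Commun. Math. Phys. **99** (1985) 389–434
[`Balaban1985BackgroundPropagators`, "B9"]; [3] = T. Bałaban, *Propagators and renormalization transformations for lattice gauge theories. I*,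
Commun. Math. Phys. **95** (1984) 17–40 [`Balaban1984PropagatorsI`]; [4] = part II, Commun. Math. Phys. **96** (1984) 223–250 [`Balaban1984PropagatorsII`].

statement-level skeleton of published theorems with citation tags; proofs where landed; nothing here is a claim about the
Yang–Mills mass gap

THE PRINTED LOCUS (verbatim, held `paper:balaban1985-cmp99-background-propagators`, journal page = PDF page + 388; page owner r06).  Cor. 3.6 p. 408 l. 3–11:
*«Applying the gauge transformation u we get U′ = U^u = e^{iηA} with A satisfying the inequalities in (3.35) … Corollary 3.6 If a configuration U satisfies (3.35)
with O(1)Mα₀ ≦ a₁, and Ω′₀ ⊂ □ for a cube □ of the class described in this condition, then Theorems 3.1-3.3 hold for the operators G′(U), (Q′(U)G′²(U)Q′\*(U))⁻¹,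
G(U) constructed for the sequence {Ω′_j}.  This follows from Corollary 3.5 applied to the configuration U′ = U^u, and we have to recall only that all the results
of these theorems are gauge invariant»*; p. 408 l. 28–33: *«In [4] we have proved all theorems under the assumption that R, M are sufficiently large.  We take these
numbers as powers of L … M = KR₀M₀»*; p. 408 l. 43 – p. 409 l. 5: *«For n ≧ 0 we have dist(Ω₀(□)ᶜ, □̃⁴) < 2R₀M₀L^jη, hence Ω₀(□) ⊂ □̃⁵.  We have assumed that the
number O(1) in the condition (3.35) can be taken as equal to 12, thus the cube □̃⁵ is contained in one of the cubes for which this condition holds … The operators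
constructed for this sequence, which we denote by G′_□(U), C_□(U) = (Q′(U)G′_□²(U)Q′\*(U))⁻¹, G_□(U), satisfy all the inequalities of Theorems 3.1–3.3»*; (3.87)
p. 409 *«G₀ = Σ_□ h_□G_□h_□»*; p. 410 l. 13–15: *«We are interested in localization for the gauge field U.  A propagator G′_□ depends on U restricted to Ω₀(□) ⊂
□̃⁵, and the operator K(h) is semi-local»*; (3.26) p. 395 *«Δ_a(U) = Δ(U) + D_UR(U)D*_U + Q\*(U)aQ(U)»* (its rows read `U` on the plaquettes of (3.4)∕(3.10) pp. 391–392,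
on the divergence rows, and through the averaging operators `Q(U)` of (3.13)–(3.15) pp. 392–393 whose parallel transporters run along *«a shortest contour»* (3.40)
p. 397); (3.34) p. 396 *«Δ_a(U^u) = R(u)Δ_a(U)R(u⁻¹), G(U^u) = R(u)G(U)R(u⁻¹)»*; (3.104)–(3.105) p. 414 *«Δ_ahA = hΔ_a − K(h)A − P₁(∂h)A … Δ_aG₀ = I − Σ_□K(h_□)G_□h_□ −
… = I − R»*.  [3] (1.18) p. 20: *«(Q_kA)_b = Σ_{x∈B^k(b₋)} η^{d+1}A([x, x(b)₋]) …»* (a `k`-fold averaging reads the fine bonds of ONE `k`-block pair: reach `< 2L^k`);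
[4] (2.1)–(2.4) p. 224 (the multi-level block geometry `B_j(Λ_j)`, big blocks of side `M L^jη`), (2.36) p. 229 (the partition of unity `{h_□}`).

WHY THIS FILE (cell `lit-balaban`, sub-row G-B9-LETTERS; module M5.1b-G = «Cor 3.5∕3.6 for the BOND-sector cube letter G_□», FILE G-F3 of the staged root
`pub/ym-inputs/COR35G-STATEMENTS-p02.md` v1.4 §D; the bond twin of p33's F3∕F4 `B9Cor36CubeCutoffs` for the site letter G′_□).  G-F2 (`B9Cor36GCubeLocLetter`, p641389 ✓)
proved the consumer's three per-cube algebraic inputs `hP1`, `hdef`, `hdefT` (`B9Thm310DeltaAIsUnitOfExpansion.eBlock_kernelFamilyBInv_GAY_of_localInverseCubes''`) for the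
localised transported letter `O_□ = M_χ·R(u)⁻¹·G_□(Ṽ)·R(u)·M_χ` from FIVE ROW DATA left as hypotheses (`localInverse_defect_laws_hTY`): (a) `χ = 1` on the input stencil
(`InStencilB`: two lattice steps around `f₋`, or a common bond averaging) of every `h_□`-row; (b) a bond set `D` containing every row whose input stencil meets `supp h_□`;
(c) `χ = 1` on `D`; (d) `(Δ_loc(U^u)Λ)(f) = (Δ_loc(Ṽ)Λ)(f)` for the `h_□`-rows `f`; (e) the same for `f ∈ D` and inputs `h_□·Λ`.  Print needs none of this bookkeeping
— its `G_□(U)` is the Dirichlet operator of the cube's sequence and *«depends on U restricted to Ω₀(□) ⊂ □̃⁵»* (p. 410), inside ONE class cube where `U^u = e^{iηA}`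
(p. 409 l. 1–3) — but the (R)-design's letter `GACubeY … V = Δ_{a,□}(V)⁻¹` reads `V` on the whole member torus, so the (R)-twin reads it at a field `Ṽ_□` LOCALISED to the
class cube and must then show that the rows that matter do not see the difference.  THIS FILE is that geometric discharge, at the cut-offs of record of p33's
`B9Cor36CubeCutoffs` (shared with the site sector, so ONE (3.35) gauge∕field datum `(u, A, Q)` serves both letters of a cube): `χ_□ := chiY i □` (plateau `= 1` within
`3S_j` of the centre of the cube's big block `β`, `S_j = M_h·L^{j+1}`), `Ṽ_□ := locCfgY i □ η A = e^{iηχ̃_□A}` (`χ̃_□ = chiTY i □ = 1` within `3.75S_j`), def-Y's taxicab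
transporter `parBY` for the `Q`-tables, and the datum `U^u = e^{iηA}` on the bonds of a torus set `Q ⊇ {within 3S_j + 2}` (p33's `exists_gauge_fld_of_reg335Cube`).
THE RADII (all about the centre of `β`, in p33's integer torus windows `NearC i □ r`): `supp h_□ ⊂ {≤ S_j}` (p33); one lattice touch costs `1`, a `J`-fold averaging
through a bond costs its reach `2L^J − 1 ≤ S_j − 1` each way for the levels `J ≤ j + 2` that occur within `3S_j` (the level window of r05∕[4] (2.2)–(2.4)) — GIVEN
«M sufficiently large» in the form `2L ≤ M_h` (DISPLAYED hypothesis `hM`; with the index's `M_h = L^a` this is `a ≥ 2`, print's `M = KR₀M₀`); hence: input stencils of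
the `h_□`-rows `⊂ {≤ 3S_j − 2}`, `D^B_□ ⊂ {≤ 3S_j − 2}` (inside the `χ_□`-plateau `3S_j`); the fields read by those rows — plaquette edges, divergence rows, and every
rung of every `Q`-transporter whose averaging sees a non-zero input — `⊂ {≤ 3S_j + 1}` (inside the `χ̃_□`-plateau and inside `Q`), the transposed rows being read in
G-F2's GUARDED form (a `Q*`-row transporter is read only when its averaging sees `supp h_□`; unguarded it would reach `5S_j`).

WHAT THIS FILE PROVES (THEOREMS + one `def` with a body, `DB`; 0 `def … : Prop`, 0 sorry).
* §1 torus bookkeeping in `NearC`: `nearC_of_touch` (+1 per lattice touch, p21's label norm), `nearC_of_supDist_le` (+K per torus sup-distance K, dag-n06-j's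
  `circAbs_le_of_supDist_le`), `boxEquiv_shift`, `SC_eq`, ★ `two_pow_le_SC` (`2L^J ≤ S_j` for `J ≤ j + 2` under `2L ≤ M_h`), `lvl_le_of_qK_ne_zero_of_nearC` (the level
  window `J ≤ j + 2` within `3S_j`, r05's `lev_ends_bounds` + p33's `levY_le_succ_of_nearC`), ★ `nearC_base_of_qK` ∕ ★ `nearC_of_qK_of_base` (an averaging through a
  bond within `r` has its base point within `r + S_j − 1` and averages only bonds within a further `S_j − 1`; dag-n06-j's `supDist_embIter_src_le_of_qK_ne_zero`),
  ★ `nearC_rungs_of_base` (every rung of def-Y's taxicab run `x(y) → b₋` stays within `S_j` of the base point; n06-i's `supDist_rungSites_taxiSteps_le`).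
* §2 ★ `nearC_of_inStencilB` (the input stencil of a row within `r ≤ S_j + 2` lies within `r + 2(S_j − 1)`), `inStencilB_symm`; the row set `DB i □` (:= the bonds
  whose input stencil meets `supp h_□`) with `mem_DB` (= G-F2's (b)), ★ `nearC_of_mem_DB` (`⊂ {≤ 3S_j − 2}`); ★ `chiY_eq_one_of_inStencilB_hT` (= (a) at `χ_□`) and ★
  `chiY_eq_one_of_mem_DB` (= (c) at `χ_□`), by p33's `chiY_eq_one_of_nearC`.
* §3 ★ `deltaLocY_apply_congr_cfg_guarded` — G-F2's row congruence of `Δ_loc` with the OUTER `Q*`-transporter guarded too (read only when the averaging sees a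
  non-zero input; def-Y's `OpsYDeltaALocalAgree` pointwise congruences + `QsY_eq_transpose`); `plaqAgreeY_of_collar`, `nearC_plaq_of_row`; ★★ `row_agree_of_hT` (= (d))
  and ★★ `row_agree_of_mem_DB` (= (e)) from COLLAR AGREEMENT `W = V` on the bonds based within `3S_j + 1` and agreement of the `Q`-transporter tables of a generic `parB`
  on the averaging pairs with base point within `2S_j − 1` and level `≤ j + 2`; ★ `parBY_agree_of_collar` — the latter for def-Y's `parBY` from collar agreement
  (`parBY_congr_of_agree` + §1's rung bound).
* §4 ★ `collar_gaugeY_locCfgY` — collar agreement of `U^u` and `Ṽ_□ = locCfgY i □ η A` from the datum `hQ : {within 3S_j + 2} ⊆ Q`, `hgA : U^u = e^{iηA}` on the bonds of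
  `Q` (p33's `chiTY_eq_one_of_nearC`, `fluct_cutFldY_of_eq_one`) — the SAME datum shapes as p33's `localInverse_laws_hTY_parSymY`.
* §5 ★★★ `localInverse_defect_laws_chiY` — the consumer's `hP1 ∧ hdef ∧ hdefT` for `Oc □ := fun _ => locLetterBY i □ parS parB u (chiY i □) V`, generic gauge-law
  transporter `parB` and background `V`, from: `2L ≤ M_h`, `IsGaugeLawB parB`, collar agreement of `U^u` and `V`, `Q`-table agreement, and `IsUnit Δ_{a,□}(V)`; ★★★
  `localInverse_defect_laws_chiY_parBY` — the same at `parB := parBY i`, `V := locCfgY i □ η A` from the (3.35) datum `(hQ, hgA)` alone plus `2L ≤ M_h` and `IsUnit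
  Δ_{a,□}(Ṽ_□)` (Cor 3.5's content for the cube letter at the localised field — FILE G-F5, DISPLAYED).  Remaining displayed inputs of the consumer after this file:
  `hE` (the (3.42) block of `O_□`, FILES G-F4–G-F6) and the defect majorants (G-F6).

HONEST SCOPE.  Finite torus geometry and finite-dimensional operator algebra over def-Y's, r05's and p33's DEFINED objects; integer radii about the centre of the
cube's big block in p33's windows, cruder than print's `□̃ⁿ` bookkeeping but inside it (everything read lies within `3S_j + 2 < 3.75S_j`, print's datum cube is `□̃⁵`
of half-side `6S_j` about the same centre, «O(1) = 12»).  «M sufficiently large» enters ONLY as the displayed `2L ≤ M_h` (reach of a `(j+2)`-fold averaging `≤ S_j − 1`);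
for `M_h = L` a sharper forward-block argument would be needed and is NOT given.  The letter `O_□` is the (R)-design's reading of print's `G_□(U)` (Dirichlet letter of
the cube sequence, which needs no localisation, cut-off or defect): a function of the CHOSEN gauge `u`, field `A` and datum set `Q`, NOT gauge-covariant.  DEFECT
LABEL: `E_□ = locDefectBY …`, `E♯_□ = locDefectTBY …` in the conclusions are (R)-design terms, NOT in print (`= 0` for print's `G_□` and for r05's un-cut `GACubeY`);
their majorants are G-F6's business.  NO estimate of [B9] is proved or used; `IsUnit Δ_{a,□}(Ṽ_□)` is a HYPOTHESIS (G-F5); the datum `(hQ, hgA)` is inhabited by p33's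
`exists_gauge_fld_of_reg335Cube` on a `Reg335Cube` (the (3.35) class cube) — not a vacuous schema; count-neutral; no summit ∕ sub-problem
statement is proved; nothing continuum ∕ OS ∕ mass-gap ∕ Clay; YM mass gap NOT proved by any of this (Track A conditional rung).  No `sorry`, no `axiom`, no `… : Prop`
fact, no `instance`, no `notation`.  NEW file; nothing landed is modified.  Cell `lit-balaban`, seat `lit-balaban-p38` gen 42, 2026-08-28; `--supports
stmt-QuantumFields-19200` as helper.
Net new unproved facts: 0.
-/

noncomputable section

namespace Literature.MathematicalPhysics.QuantumFieldTheory.Balaban1983to89.B9Cor36GCubeCutoffsB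

open Node00
open B9Eq39Adjoint (R R_smul R_zero fluct)
open B9Thm37CubeCoverCommutators (cutMulY cutMulY_apply hTY hTY_apply)
open B9Eq3104CutoffCommutators (hBdY hBdY_apply deltaLocY)
open B9Eq3104CommutatorSupport (trLiftY_apply_eq_zero_of aY_apply_eq_zero_of touch_symm touch_of_gradK_ne_zero touch_src_of_curlK_ne_zero
  touch_src_edgeY touch_plaq_of_curlK_ne_zero)
open B9Eq3104CommutatorSizesAvg (aY_apply)
open B9CubeLettersBondOpsL0 (deltaACubeY GACubeY)
open B9CubeBondRowAgreementNearH (lvl_le_of_qK_ne_zero_of_hT ends_of_qK_ne_zero circAbs_le_of_torusSupNorm_lt)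
open B9Cor36GCubeLocLetter (InStencilB inStencilB_refl deltaLocY_apply_congr_cfg' locLetterBY locProjBY locP1BY locDefectBY locDefectTBY
  localInverse_defect_laws_hTY)
open B9Cor36CubeCutoffs (SC NearC NearC.mono one_le_SC nine_le_SC nearC_of_hT_ne_zero nearC_shiftY nearC_shiftY_symm levY_le_succ_of_nearC chiY chiTY
  chiY_eq_one_of_nearC chiTY_eq_one_of_nearC locCfgY locCfgY_apply fluct_cutFldY_of_eq_one)
open B9DeltaALocalReadingsInCollarY (circAbs_le_of_supDist_le supDist_embIter_src_le_of_qK_ne_zero)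
open B9Eq340TaxiTelescope (supDist_rungSites_taxiSteps_le)
open B9Eq340StepLasso (rungSites taxiSteps)
open B9TorusLabelDistanceToolkit (supDist_triangle)
open B3TorusRadialSums (supDist_comm)
open LatticeFieldCalculus (supDist)
open Node00.OpsYNablaBridge (chartY divK_apply)
open Node00.OpsYDeltaALocalAgree (PlaqAgreeY hessY_apply_congr gradY_apply_congr divY_apply_congr QY_apply_congr parBY_congr_of_agree)
open B6KLevelCensusIndexV1 (KIdx)
open B6Cover236MultiLevelBlocks (cubes)
open B6Partition118KLevelTorus (hT)
open B4TorusKernel.MultiPeriod (torusSupNorm circAbs)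
open B4Sect5Torus (circAbs_add_le)
open B9CubeSequence408 (sI ctrC circAbs_sub_comm)
open B6MultiLevelBoxOperator (N0 bigSide)
open B6MultiLevelTorusOperator (one_le_of_mem)
open B6GlobalChartV1 (PV boxEquiv boxEquiv_apply toBox)
open B6Ineq2142KLevelV1 (lev_ends_bounds)
open B9Eq360DeltaPrimeAY (AfldY)
open B15DeterminingSets (embIter)
open scoped Matrix

variable {d ℓ : ℕ} {hd : 1 ≤ d + 1} {hL : Odd (ℓ + 1) ∧ 1 < ℓ + 1} {b₀ b₁ : ℝ}
variable {𝔸 : Type} [NormedRing 𝔸] [NormedAlgebra ℂ 𝔸] [CompleteSpace 𝔸]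

/-! ## §1 Torus bookkeeping: one lattice step, a sup-distance, and the reach of a bond averaging cost `1`, `K`, `S_j − 1` in `NearC` -/

section Geometry

variable (i : KIdx d ℓ hd hL b₀ b₁) (c : ↥(cubes (toKT i).D.toDomains))

/-- ONE TOUCH COSTS ONE: a site within torus sup-distance `1` (p21's label norm) of a site within `r` of the centre of `β` is within `r + 1`.
[cite: Balaban1984PropagatorsII, (2.2) p.224 (torus distance), bookkeeping] -/
theorem nearC_of_touch {r : ℤ} {z u : SiteY i} (hz : NearC i c r z.1) (h : torusSupNorm (toKT i).NB (z.1 - u.1) ≤ 1) : NearC i c (r + 1) u.1 := by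
  intro μ
  have hN : 1 ≤ (toKT i).NB μ := one_le_of_mem z.2 μ
  have h2 : torusSupNorm (toKT i).NB (z.1 - u.1) < ((2 : ℕ) : ℝ) := lt_of_le_of_lt h (by norm_num)
  have h1 : circAbs ((toKT i).NB μ) ((z.1 - u.1) μ) ≤ (2 : ℤ) - 1 := by exact_mod_cast circAbs_le_of_torusSupNorm_lt h2 μ
  have h1' : circAbs ((toKT i).NB μ) (u.1 μ - z.1 μ) ≤ 1 := by
    rw [circAbs_sub_comm hN]; simpa [Pi.sub_apply] using h1
  have t := circAbs_add_le hN (u.1 μ - z.1 μ) (z.1 μ - ctrC c μ)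
  rw [show u.1 μ - z.1 μ + (z.1 μ - ctrC c μ) = u.1 μ - ctrC c μ by ring] at t
  linarith [hz μ]

/-- A SUP-DISTANCE COSTS ITSELF: a torus point `w` with `|e⁻¹z − w|_∞ ≤ K` (the lattice-calculus torus sup-distance) for a site `z` within `r` of the centre of `β`
is within `r + K` (dag-n06-j's `circAbs_le_of_supDist_le` + the circular triangle inequality). [cite: Balaban1984PropagatorsII, (2.2) p.224, bookkeeping] -/
theorem nearC_of_supDist_le {r : ℤ} {z : SiteY i} (hz : NearC i c r z.1) {w : Site (PV d ℓ i.m i.K hd hL) 0} {K : ℕ}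
    (h : supDist ((boxEquiv i.hN).symm z) w ≤ K) : NearC i c (r + K) (boxEquiv i.hN w).1 := by
  intro μ
  have hN : 1 ≤ (toKT i).NB μ := one_le_of_mem z.2 μ
  have e : (toKT i).NB μ = (PV d ℓ i.m i.K hd hL).sitesPerDir 0 := i.hN μ
  have h1 : circAbs ((toKT i).NB μ) (((w μ).val : ℤ) - z.1 μ) ≤ K := by rw [e]; exact circAbs_le_of_supDist_le i h μ
  have hw : (boxEquiv i.hN w).1 μ = ((w μ).val : ℤ) := by rw [boxEquiv_apply]; rfl
  have t := circAbs_add_le hN (((w μ).val : ℤ) - z.1 μ) (z.1 μ - ctrC c μ)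
  rw [show ((w μ).val : ℤ) - z.1 μ + (z.1 μ - ctrC c μ) = ((w μ).val : ℤ) - ctrC c μ by ring] at t
  rw [hw]
  linarith [hz μ]

/-- `e(x + e_κ) = (e x) + e_κ`: the chart intertwines the torus shift and def-Y's `shiftY`. [cite: Balaban1984PropagatorsII, (2.1) p.224, dictionary] -/
theorem boxEquiv_shift (x : Site (PV d ℓ i.m i.K hd hL) 0) (κ : Fin (d + 1)) : boxEquiv i.hN (x.shift κ) = shiftY i κ (boxEquiv i.hN x) := by
  apply (boxEquiv i.hN).symm.injective
  rw [Node00.boxEquiv_symm_shiftY, Equiv.symm_apply_apply, Equiv.symm_apply_apply]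

/-- `S_j = M_h·L^{j+1}` as an integer. [cite: Balaban1985BackgroundPropagators, p.408, dictionary] -/
theorem SC_eq : SC i c = ((toKT i).Mh : ℤ) * ((ℓ : ℤ) + 1) ^ (c.1.1 + 1) := by
  show sI ℓ (toKT i).Mh c.1.1 = _
  unfold sI bigSide; push_cast; ring

/-- **THE REACH FITS IN ONE BIG BLOCK under «M sufficiently large» in the form `2L ≤ M_h`**: for an averaging level `J ≤ j + 2`, `2L^J ≤ S_j` — so the reach
`2L^J − 1` of a coarse `J`-bond ([3] (1.18)) is at most `S_j − 1`.  (With the index's `M_h = L^a` this is `a ≥ 2`; for `a = 1` a forward-interval argument à la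
N06's `blkOf_toBox_rung_eq` would be needed instead — not done here.) [cite: Balaban1985BackgroundPropagators, p.408 («R, M are sufficiently large»); Balaban1984PropagatorsI, (1.18) p.20] -/
theorem two_pow_le_SC (hM : 2 * (ℓ + 1) ≤ i.Mh) {J : ℕ} (hJ : J ≤ c.1.1 + 2) : 2 * ((ℓ : ℤ) + 1) ^ J ≤ SC i c := by
  rw [SC_eq]
  show 2 * ((ℓ : ℤ) + 1) ^ J ≤ (i.Mh : ℤ) * ((ℓ : ℤ) + 1) ^ (c.1.1 + 1)
  have h1 : (2 * (ℓ + 1) ^ J : ℕ) ≤ 2 * (ℓ + 1) ^ (c.1.1 + 2) := Nat.mul_le_mul_left _ (Nat.pow_le_pow_right (Nat.succ_pos ℓ) hJ)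
  have h2 : 2 * (ℓ + 1) ^ (c.1.1 + 2) = (2 * (ℓ + 1)) * (ℓ + 1) ^ (c.1.1 + 1) := by ring
  have h3 : (2 * (ℓ + 1)) * (ℓ + 1) ^ (c.1.1 + 1) ≤ i.Mh * (ℓ + 1) ^ (c.1.1 + 1) := Nat.mul_le_mul_right _ hM
  have : ((2 * (ℓ + 1) ^ J : ℕ) : ℤ) ≤ ((i.Mh * (ℓ + 1) ^ (c.1.1 + 1) : ℕ) : ℤ) := by exact_mod_cast h1.trans (h2 ▸ h3)
  push_cast at this
  exact this

/-- THE LEVEL WINDOW NEAR □: a fine bond issuing from within `3S_j` of the centre of `β` is averaged only by index bonds of level `J ≤ j + 2`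
(`J − 1 ≤ lev(f₋) ≤ j + 1`). [cite: Balaban1984PropagatorsII, (2.2)–(2.4) p.224; Balaban1985BackgroundPropagators, p.408] -/
theorem lvl_le_of_qK_ne_zero_of_nearC {r : ℤ} (hr : r ≤ 3 * SC i c) {y : IBondY i} {f : FBondY i} (hf : NearC i c r (chartY i f.src).1)
    (h : qK i y f ≠ 0) : (y.1.1 : ℕ) ≤ c.1.1 + 2 := by
  obtain ⟨-, -, -, -, hRM⟩ := B9CubeBondRowAgreementNearH.side_conds i
  have h1 := (lev_ends_bounds i.hN i.D i.hk (le_trans one_le_two i.hk2) hRM y (ends_of_qK_ne_zero i h)).1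
  have h2 := levY_le_succ_of_nearC i c hr hf
  change (y.1.1 : ℕ) - 1 ≤ levY i (chartY i f.src) at h1
  omega

/-- ★ **THE BASE POINT OF AN AVERAGING THROUGH A NEAR BOND IS NEAR**: if `q(y, f) ≠ 0` with `f₋` within `r ≤ 3S_j` of the centre of `β`, then `x(y) = embIter J y₋` is within
`r + (S_j − 1)` (reach `2L^J − 1 ≤ S_j − 1`, dag-n06-j's `supDist_embIter_src_le_of_qK_ne_zero`). [cite: Balaban1984PropagatorsI, (1.18) p.20; Balaban1985BackgroundPropagators, (3.13)–(3.15) p.392–393, p.408] -/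
theorem nearC_base_of_qK (hM : 2 * (ℓ + 1) ≤ i.Mh) {r : ℤ} (hr : r ≤ 3 * SC i c) {y : IBondY i} {f : FBondY i}
    (hf : NearC i c r (chartY i f.src).1) (h : qK i y f ≠ 0) :
    NearC i c (r + (SC i c - 1)) (boxEquiv i.hN (embIter (y.1.1 : ℕ) y.1.2.src)).1 := by
  have hreach := supDist_embIter_src_le_of_qK_ne_zero i h
  have hJ := two_pow_le_SC i c hM (lvl_le_of_qK_ne_zero_of_nearC i c hr hf h)
  have h1 : supDist ((boxEquiv i.hN).symm (chartY i f.src)) (embIter (y.1.1 : ℕ) y.1.2.src) ≤ 2 * (ℓ + 1) ^ (y.1.1 : ℕ) - 1 := by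
    rw [show (boxEquiv i.hN).symm (chartY i f.src) = f.src from Equiv.symm_apply_apply _ _, supDist_comm]; exact hreach
  have h2 := nearC_of_supDist_le i c hf h1
  refine h2.mono i c ?_
  have h3 : (((2 * (ℓ + 1) ^ (y.1.1 : ℕ) - 1 : ℕ) : ℤ)) ≤ SC i c - 1 := by
    have h4 : 1 ≤ 2 * (ℓ + 1) ^ (y.1.1 : ℕ) := le_trans (Nat.one_le_pow _ _ (Nat.succ_pos ℓ)) (Nat.le_mul_of_pos_left _ two_pos)
    rw [Nat.cast_sub h4]; push_cast; linarith [hJ]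
  linarith

/-- ★ **A BOND AVERAGED FROM A NEAR BASE POINT IS NEAR**: if `x(y)` is within `r′` and `q(y, b) ≠ 0` with `J ≤ j + 2`, then `b₋` is within `r′ + (S_j − 1)`.
[cite: Balaban1984PropagatorsI, (1.18) p.20; Balaban1985BackgroundPropagators, (3.13)–(3.15) p.392–393, p.408] -/
theorem nearC_of_qK_of_base (hM : 2 * (ℓ + 1) ≤ i.Mh) {r' : ℤ} {y : IBondY i} (hJ : (y.1.1 : ℕ) ≤ c.1.1 + 2)
    (hx : NearC i c r' (boxEquiv i.hN (embIter (y.1.1 : ℕ) y.1.2.src)).1) {b : FBondY i} (hb : qK i y b ≠ 0) :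
    NearC i c (r' + (SC i c - 1)) (chartY i b.src).1 := by
  have hreach := supDist_embIter_src_le_of_qK_ne_zero i hb
  have h1 : supDist ((boxEquiv i.hN).symm (boxEquiv i.hN (embIter (y.1.1 : ℕ) y.1.2.src))) b.src ≤ 2 * (ℓ + 1) ^ (y.1.1 : ℕ) - 1 := by
    rw [Equiv.symm_apply_apply]; exact hreach
  have h2 := nearC_of_supDist_le i c hx h1
  refine h2.mono i c ?_
  have hJ' := two_pow_le_SC i c hM hJ
  have h3 : (((2 * (ℓ + 1) ^ (y.1.1 : ℕ) - 1 : ℕ) : ℤ)) ≤ SC i c - 1 := by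
    have h4 : 1 ≤ 2 * (ℓ + 1) ^ (y.1.1 : ℕ) := le_trans (Nat.one_le_pow _ _ (Nat.succ_pos ℓ)) (Nat.le_mul_of_pos_left _ two_pos)
    rw [Nat.cast_sub h4]; push_cast; linarith [hJ']
  linarith

/-- ★ **THE RUNGS OF A `Q`-TRANSPORTER RUN FROM A NEAR BASE POINT ARE NEAR**: every rung bond of def-Y's taxicab run `x(y) → b₋` (`q(y, b) ≠ 0`, `J ≤ j + 2`, `x(y)`
within `r′`) has both ends within `r′ + S_j` of the centre of `β` (n06-i's `supDist_rungSites_taxiSteps_le`: the run stays within `|x(y) − b₋|_∞` of its start).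
[cite: Balaban1985BackgroundPropagators, (3.40) p.397 («a shortest contour»), (3.13)–(3.15) p.392–393, p.410 l.14–15] -/
theorem nearC_rungs_of_base (hM : 2 * (ℓ + 1) ≤ i.Mh) {r' : ℤ} {y : IBondY i} (hJ : (y.1.1 : ℕ) ≤ c.1.1 + 2)
    (hx : NearC i c r' (boxEquiv i.hN (embIter (y.1.1 : ℕ) y.1.2.src)).1) {b : FBondY i} (hb : qK i y b ≠ 0) :
    ∀ r ∈ rungSites (taxiSteps (List.finRange (d + 1)) (embIter (y.1.1 : ℕ) y.1.2.src) b.src) (embIter (y.1.1 : ℕ) y.1.2.src),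
      NearC i c (r' + SC i c) (boxEquiv i.hN r.1).1 ∧ NearC i c (r' + SC i c) (boxEquiv i.hN (r.1.shift r.2.1)).1 := by
  intro r hr
  have hreach := supDist_embIter_src_le_of_qK_ne_zero i hb
  have hrun := supDist_rungSites_taxiSteps_le (embIter (y.1.1 : ℕ) y.1.2.src) b.src r hr
  have hJ' := two_pow_le_SC i c hM hJ
  have h4 : 1 ≤ 2 * (ℓ + 1) ^ (y.1.1 : ℕ) := le_trans (Nat.one_le_pow _ _ (Nat.succ_pos ℓ)) (Nat.le_mul_of_pos_left _ two_pos)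
  have h3 : (((2 * (ℓ + 1) ^ (y.1.1 : ℕ) - 1 : ℕ) : ℤ)) ≤ SC i c - 1 := by rw [Nat.cast_sub h4]; push_cast; linarith [hJ']
  have key : ∀ w, supDist (embIter (y.1.1 : ℕ) y.1.2.src) w ≤ supDist (embIter (y.1.1 : ℕ) y.1.2.src) b.src → NearC i c (r' + SC i c) (boxEquiv i.hN w).1 := by
    intro w hw
    have h1 : supDist ((boxEquiv i.hN).symm (boxEquiv i.hN (embIter (y.1.1 : ℕ) y.1.2.src))) w ≤ 2 * (ℓ + 1) ^ (y.1.1 : ℕ) - 1 := by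
      rw [Equiv.symm_apply_apply]; exact hw.trans hreach
    exact (nearC_of_supDist_le i c hx h1).mono i c (by linarith)
  exact ⟨key _ hrun.1, key _ hrun.2⟩

end Geometry

/-! ## §2 The input stencils of the `h_□`-rows and the row set `D^B_□` lie within `3S_j`: G-F2's `hχ`, `hD`, `hχD` at `χ := χ_□` -/

section Stencil

variable (i : KIdx d ℓ hd hL b₀ b₁) (c : ↥(cubes (toKT i).D.toDomains))

omit [NormedAlgebra ℂ 𝔸] [CompleteSpace 𝔸] in
/-- the input-stencil relation is symmetric. [cite: Balaban1985BackgroundPropagators, (3.26) p.395, bookkeeping] -/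
theorem inStencilB_symm {f f' : FBondY i} (h : InStencilB i f f') : InStencilB i f' f := by
  rcases h with ⟨u, h1, h2⟩ | ⟨y, h1, h2⟩
  · exact Or.inl ⟨u, touch_symm i h2, touch_symm i h1⟩
  · exact Or.inr ⟨y, h2, h1⟩

/-- ★ **THE INPUT STENCIL OF A NEAR ROW IS NEAR**: if `f₋` is within `r ≤ S_j + 2` of the centre of `β` and `f′` is in the input stencil of `f`, then `f′₋` is within
`r + 2(S_j − 1)` (two lattice steps: `+2`; a common averaging at level `J ≤ j + 2`: base point `+ (S_j − 1)`, then `+ (S_j − 1)`).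
[cite: Balaban1985BackgroundPropagators, (3.26) p.395, p.408, p.410 l.14–15; Balaban1984PropagatorsI, (1.18) p.20] -/
theorem nearC_of_inStencilB (hM : 2 * (ℓ + 1) ≤ i.Mh) {r : ℤ} (hr : r ≤ SC i c + 2) {f f' : FBondY i} (hf : NearC i c r (chartY i f.src).1)
    (hs : InStencilB i f f') : NearC i c (r + 2 * (SC i c - 1)) (chartY i f'.src).1 := by
  have hS := nine_le_SC i c
  rcases hs with ⟨u, h1, h2⟩ | ⟨y, h1, h2⟩
  · exact ((nearC_of_touch i c (nearC_of_touch i c hf h1) h2)).mono i c (by linarith)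
  · have hr3 : r ≤ 3 * SC i c := by linarith
    have hJ := lvl_le_of_qK_ne_zero_of_nearC i c hr3 hf h1
    have hx := nearC_base_of_qK i c hM hr3 hf h1
    exact (nearC_of_qK_of_base i c hM hJ hx h2).mono i c (by linarith)

/-- ★ G-F2's `hχ` AT `χ := χ_□`: the inner cut-off is `1` on the input stencil of every `h_□`-row (`supp h_□ ⊂ S_j`, stencil `⊂ 3S_j − 2`, `χ_□ = 1` within `3S_j`).
[cite: Balaban1985BackgroundPropagators, Cor. 3.6 p.408, (3.87) p.409; Balaban1984PropagatorsII, (2.36) p.229] -/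
theorem chiY_eq_one_of_inStencilB_hT (hM : 2 * (ℓ + 1) ≤ i.Mh) {f f' : FBondY i} (hf : hT (toKT i).D c (chartY i f.src) ≠ 0) (hs : InStencilB i f f') :
    chiY i c (chartY i f'.src) = 1 := by
  have hS := nine_le_SC i c
  have h := nearC_of_inStencilB i c hM (by linarith) (nearC_of_hT_ne_zero i c hf) hs
  exact chiY_eq_one_of_nearC i c (by linarith) h

open Classical in
/-- **THE ROW SET `D^B_□` OF THE TRANSPOSED LAW**: the bonds whose input stencil meets `supp h_□`. [cite: Balaban1985BackgroundPropagators, (3.105) p.414, p.410 l.14–15] -/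
def DB : Finset (FBondY i) := Finset.univ.filter fun f => ∃ f', InStencilB i f f' ∧ hT (toKT i).D c (chartY i f'.src) ≠ 0

omit [NormedAlgebra ℂ 𝔸] [CompleteSpace 𝔸] in
/-- G-F2's `hD`: by definition of `D^B_□`. [cite: Balaban1985BackgroundPropagators, (3.105) p.414, bookkeeping] -/
theorem mem_DB {f f' : FBondY i} (hs : InStencilB i f f') (h : hT (toKT i).D c (chartY i f'.src) ≠ 0) : f ∈ DB i c := by
  classical
  unfold DB
  simp only [Finset.mem_filter, Finset.mem_univ, true_and]
  exact ⟨f', hs, h⟩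

/-- ★ the rows of `D^B_□` issue from within `3S_j − 2` of the centre of `β`. [cite: Balaban1985BackgroundPropagators, (3.105) p.414, p.408] -/
theorem nearC_of_mem_DB (hM : 2 * (ℓ + 1) ≤ i.Mh) {f : FBondY i} (hf : f ∈ DB i c) : NearC i c (3 * SC i c - 2) (chartY i f.src).1 := by
  classical
  unfold DB at hf
  simp only [Finset.mem_filter, Finset.mem_univ, true_and] at hf
  obtain ⟨f', hs, h⟩ := hf
  have hS := nine_le_SC i c
  have h1 := nearC_of_inStencilB i c hM (by linarith) (nearC_of_hT_ne_zero i c h) (inStencilB_symm i hs)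
  exact h1.mono i c (by linarith)

/-- ★ G-F2's `hχD` AT `χ := χ_□`. [cite: Balaban1985BackgroundPropagators, Cor. 3.6 p.408, (3.87) p.409] -/
theorem chiY_eq_one_of_mem_DB (hM : 2 * (ℓ + 1) ≤ i.Mh) {f : FBondY i} (hf : f ∈ DB i c) : chiY i c (chartY i f.src) = 1 :=
  chiY_eq_one_of_nearC i c (by linarith [nine_le_SC i c]) (nearC_of_mem_DB i c hM hf)

end Stencil

/-! ## §3 The background reads of the `h_□`-rows and of the `D^B_□`-rows lie within `3S_j + 1`: G-F2's `hrow`, `hrowD` from collar agreement -/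

section Reads

variable (i : KIdx d ℓ hd hL b₀ b₁) (c : ↥(cubes (toKT i).D.toDomains))

/-- the `Q`-transport letter read only where its input is non-zero: `(Q(U)Λ)(y) ≠ 0 ⟹ Λ ≠ 0` somewhere on the row of `y`.
[cite: Balaban1985BackgroundPropagators, (3.13)–(3.15) p.392–393, bookkeeping] -/
theorem exists_of_QY_ne_zero (parB : BondParY 𝔸 i) (U : CfgY 𝔸 i) (Λ : FBondY i → 𝔸) (y : IBondY i) (h : QY i parB U Λ y ≠ 0) :
    ∃ b, qK i y b ≠ 0 ∧ Λ b ≠ 0 := by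
  by_contra hne
  push Not at hne
  exact h (trLiftY_apply_eq_zero_of (qK i) _ Λ y fun b hb => hne b hb)

/-- ★ **G-F2's `deltaLocY_apply_congr_cfg` WITH THE OUTER `Q`-TRANSPORTER GUARDED TOO**: the transporter `U(Γ_{x(y), f₋})` of the `Q*`-row of `f` is read only
when the averaging `y` sees the input (`∃ b, q(y,b) ≠ 0 ∧ Λ(b) ≠ 0`). [cite: Balaban1985BackgroundPropagators, p.410 l.14–15, (3.13)–(3.15) p.392–393, (3.26) p.395] -/
theorem deltaLocY_apply_congr_cfg_guarded (parB : BondParY 𝔸 i) {U U' : CfgY 𝔸 i} (Λ : FBondY i → 𝔸) (f : FBondY i)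
    (hpl : ∀ p, (cocurlK i f p ≠ 0 ∨ ∃ m, edgeY i p m = f) → PlaqAgreeY i U U' p)
    (hb : U f.dir f.src = U' f.dir f.src)
    (hdv : ∀ (z : SiteY i) (b : FBondY i), gradK i f z ≠ 0 → divK i z b ≠ 0 → Λ b ≠ 0 → U b.dir b.src = U' b.dir b.src)
    (hq : ∀ (y : IBondY i) (b : FBondY i), qK i y f ≠ 0 → qK i y b ≠ 0 → (∃ b', qK i y b' ≠ 0 ∧ Λ b' ≠ 0) →
      parB U (embIter (y.1.1 : ℕ) y.1.2.src) b.src = parB U' (embIter (y.1.1 : ℕ) y.1.2.src) b.src) :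
    deltaLocY i parB U Λ f = deltaLocY i parB U' Λ f := by
  have hQ : ∀ y : IBondY i, qK i y f ≠ 0 → QY i parB U Λ y = QY i parB U' Λ y := fun y hy =>
    QY_apply_congr fun b hb' => ⟨rfl, fun hΛ => hq y b hy hb' ⟨b, hb', hΛ⟩⟩
  have hQs : QsY i parB U (aY i (QY i parB U Λ)) f = QsY i parB U' (aY i (QY i parB U' Λ)) f := by
    rw [QsY_eq_transpose, QsY_eq_transpose]
    refine Node00.OpsYDeltaALocalAgree.trLiftY_apply_congr fun y hy => ?_
    rw [Matrix.transpose_apply] at hy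
    refine ⟨by rw [aY_apply, aY_apply, hQ y hy], fun hne => ?_⟩
    have hne' : QY i parB U Λ y ≠ 0 := fun h0 => hne (aY_apply_eq_zero_of i h0)
    have e : qT i parB U y f = qT i parB U' y f := by unfold qT; exact hq y f hy hy (exists_of_QY_ne_zero i parB U Λ y hne')
    rw [e]
  simp only [deltaLocY, LinearMap.add_apply, Pi.add_apply, LinearMap.coe_comp, Function.comp_apply]
  rw [hessY_apply_congr hpl Λ,
    gradY_apply_congr hb (Λ := divY i U Λ) (Λ' := divY i U' Λ) fun z hz =>
      divY_apply_congr fun b hb' => ⟨rfl, fun hΛ => hdv z b hz hb' hΛ⟩, hQs]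

variable {W V : CfgY 𝔸 i}

/-- plaquette agreement from collar agreement: the four edges of a plaquette based within `r` are read within `r + 1`.
[cite: Balaban1985BackgroundPropagators, (3.1)–(3.2) p.390, p.410 l.14–15, bookkeeping] -/
theorem plaqAgreeY_of_collar (hUV : ∀ (κ : Fin (d + 1)) (w : Site (PV d ℓ i.m i.K hd hL) 0), NearC i c (3 * SC i c + 1) (boxEquiv i.hN w).1 → W κ w = V κ w)
    {r : ℤ} (hr : r ≤ 3 * SC i c) {p : PlaqY i} (hp : NearC i c r (chartY i p.src).1) : PlaqAgreeY i W V p := by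
  have h0 : NearC i c (3 * SC i c + 1) (boxEquiv i.hN p.src).1 := hp.mono i c (by linarith)
  have h1 : ∀ μ, NearC i c (3 * SC i c + 1) (boxEquiv i.hN (p.src.shift μ)).1 := fun μ => by
    rw [boxEquiv_shift]; exact (nearC_shiftY i c hp μ).mono i c (by linarith)
  exact ⟨hUV _ _ h0, hUV _ _ h0, hUV _ _ (h1 _), hUV _ _ (h1 _)⟩

/-- the plaquettes around a bond based within `r` are based within `r + 1`. [cite: Balaban1985BackgroundPropagators, (3.4) p.391, (3.10) p.392, bookkeeping] -/
theorem nearC_plaq_of_row {r : ℤ} {f : FBondY i} (hf : NearC i c r (chartY i f.src).1) {p : PlaqY i}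
    (hp : cocurlK i f p ≠ 0 ∨ ∃ m, edgeY i p m = f) : NearC i c (r + 1) (chartY i p.src).1 := by
  rcases hp with hp | ⟨m, hm⟩
  · have hp' : curlK i p f ≠ 0 := by rwa [cocurlK_eq_transpose, Matrix.transpose_apply] at hp
    exact nearC_of_touch i c hf (touch_plaq_of_curlK_ne_zero i hp')
  · have h := touch_src_edgeY i p m
    rw [hm] at h
    exact nearC_of_touch i c hf (touch_symm i h)

/-- ★ **G-F2's `hrow` FROM COLLAR AGREEMENT**: for an `h_□`-row `f` (`h_□(f₋) ≠ 0`), if `W = V` on every bond based within `3S_j + 1` of the centre of `β` (the collar) and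
the `Q`-transporter tables of `W`, `V` agree on the averaging pairs whose base point is within `2S_j − 1` (generic `parB`; for def-Y's taxicab transporter this is
§4's `parBY_agree_of_collar`), then `(Δ_loc(W)Λ)(f) = (Δ_loc(V)Λ)(f)` for every `Λ`. [cite: Balaban1985BackgroundPropagators, p.410 l.14–15 («depend on U restricted to Ω₀(□) ⊂ □̃⁵»), (3.26) p.395, p.408] -/
theorem row_agree_of_hT (hM : 2 * (ℓ + 1) ≤ i.Mh)
    (hUV : ∀ (κ : Fin (d + 1)) (w : Site (PV d ℓ i.m i.K hd hL) 0), NearC i c (3 * SC i c + 1) (boxEquiv i.hN w).1 → W κ w = V κ w)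
    {parB : BondParY 𝔸 i}
    (hpar : ∀ (y : IBondY i) (b : FBondY i), qK i y b ≠ 0 → (y.1.1 : ℕ) ≤ c.1.1 + 2 →
      NearC i c (2 * SC i c - 1) (boxEquiv i.hN (embIter (y.1.1 : ℕ) y.1.2.src)).1 →
      parB W (embIter (y.1.1 : ℕ) y.1.2.src) b.src = parB V (embIter (y.1.1 : ℕ) y.1.2.src) b.src)
    {f : FBondY i} (hf : hT (toKT i).D c (chartY i f.src) ≠ 0) (Λ : FBondY i → 𝔸) : deltaLocY i parB W Λ f = deltaLocY i parB V Λ f := by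
  have hS := nine_le_SC i c
  have hfN := nearC_of_hT_ne_zero i c hf
  refine deltaLocY_apply_congr_cfg' i parB f (fun p hp => plaqAgreeY_of_collar i c hUV (by linarith) (nearC_plaq_of_row i c hfN hp))
    (hUV _ _ (hfN.mono i c (by linarith))) (fun z b hz hb' => ?_) (fun y b hy hb' => ?_) Λ
  · -- the divergence rows of the ends of `f`: two touches
    have h1 := nearC_of_touch i c hfN (touch_of_gradK_ne_zero i hz)
    rw [divK_apply] at hb'
    have h2 := nearC_of_touch i c h1 (touch_symm i (touch_of_gradK_ne_zero i hb'))
    exact hUV _ _ (h2.mono i c (by linarith))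
  · have hJ := lvl_le_of_qK_ne_zero_of_nearC i c (by linarith) hfN hy
    exact hpar y b hb' hJ ((nearC_base_of_qK i c hM (by linarith) hfN hy).mono i c (by linarith))

/-- ★ **G-F2's `hrowD` FROM COLLAR AGREEMENT**: for a row `f ∈ D^B_□` (`f₋` within `3S_j − 2`) and inputs `h_□·Λ`: the plaquettes around `f` are based within `3S_j − 1`, the
guarded divergence ∕ averaging reads see only bonds of `supp h_□` (within `S_j`) and base points within `2S_j − 1`. [cite: Balaban1985BackgroundPropagators, p.410 l.14–15, (3.105) p.414, (3.26) p.395] -/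
theorem row_agree_of_mem_DB (hM : 2 * (ℓ + 1) ≤ i.Mh)
    (hUV : ∀ (κ : Fin (d + 1)) (w : Site (PV d ℓ i.m i.K hd hL) 0), NearC i c (3 * SC i c + 1) (boxEquiv i.hN w).1 → W κ w = V κ w)
    {parB : BondParY 𝔸 i}
    (hpar : ∀ (y : IBondY i) (b : FBondY i), qK i y b ≠ 0 → (y.1.1 : ℕ) ≤ c.1.1 + 2 →
      NearC i c (2 * SC i c - 1) (boxEquiv i.hN (embIter (y.1.1 : ℕ) y.1.2.src)).1 →
      parB W (embIter (y.1.1 : ℕ) y.1.2.src) b.src = parB V (embIter (y.1.1 : ℕ) y.1.2.src) b.src)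
    {f : FBondY i} (hfD : f ∈ DB i c) (Λ : FBondY i → 𝔸) :
    deltaLocY i parB W (cutMulY (hBdY i (hTY i c)) Λ) f = deltaLocY i parB V (cutMulY (hBdY i (hTY i c)) Λ) f := by
  have hS := nine_le_SC i c
  have hfN := nearC_of_mem_DB i c hM hfD
  -- a bond where `h_□·Λ ≠ 0` is an `h_□`-row
  have hsupp : ∀ b : FBondY i, cutMulY (hBdY i (hTY i c)) Λ b ≠ 0 → hT (toKT i).D c (chartY i b.src) ≠ 0 := by
    intro b hne h0
    apply hne
    rw [cutMulY_apply, hBdY_apply, hTY_apply]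
    rw [show hT i.D c (chartY i b.src) = 0 from h0, Complex.ofReal_zero, zero_smul]
  refine deltaLocY_apply_congr_cfg_guarded i parB _ f (fun p hp => plaqAgreeY_of_collar i c hUV (by linarith) (nearC_plaq_of_row i c hfN hp))
    (hUV _ _ (hfN.mono i c (by linarith))) (fun z b _ _ hΛ => ?_) (fun y b hy hb' ⟨b', hb'q, hb'Λ⟩ => ?_)
  · exact hUV _ _ ((nearC_of_hT_ne_zero i c (hsupp b hΛ)).mono i c (by linarith))
  · -- the averaging `y` sees the `h_□`-row `b′`: its base point is within `2S_j − 1`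
    have hb'N := nearC_of_hT_ne_zero i c (hsupp b' hb'Λ)
    have hJ := lvl_le_of_qK_ne_zero_of_nearC i c (by linarith) hb'N hb'q
    exact hpar y b hb' hJ ((nearC_base_of_qK i c hM (by linarith) hb'N hb'q).mono i c (by linarith))

/-- ★ **def-Y's TAXICAB TRANSPORTER `U(Γ_{x(y), b₋})` AGREES FOR `W`, `V` ON THE NEAR AVERAGING PAIRS** from collar agreement: base point within `2S_j − 1`, `J ≤ j + 2`
⟹ all rungs within `3S_j − 1`. [cite: Balaban1985BackgroundPropagators, (3.40) p.397, (3.13)–(3.15) p.392–393, p.410 l.14–15] -/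
theorem parBY_agree_of_collar (hM : 2 * (ℓ + 1) ≤ i.Mh)
    (hUV : ∀ (κ : Fin (d + 1)) (w : Site (PV d ℓ i.m i.K hd hL) 0), NearC i c (3 * SC i c + 1) (boxEquiv i.hN w).1 → W κ w = V κ w)
    (y : IBondY i) (b : FBondY i) (hb : qK i y b ≠ 0) (hJ : (y.1.1 : ℕ) ≤ c.1.1 + 2)
    (hx : NearC i c (2 * SC i c - 1) (boxEquiv i.hN (embIter (y.1.1 : ℕ) y.1.2.src)).1) :
    parBY i W (embIter (y.1.1 : ℕ) y.1.2.src) b.src = parBY i V (embIter (y.1.1 : ℕ) y.1.2.src) b.src :=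
  parBY_congr_of_agree _ _ fun r hr => hUV _ _ (((nearC_rungs_of_base i c hM hJ hx hb r hr).1).mono i c (by linarith))

end Reads

/-! ## §4 Collar agreement of `U^u` and `Ṽ_□ = e^{iηχ̃_□A}` from the (3.35) datum on a cube `Q ⊇ {within 3S_j + 2}` -/

section Datum

variable (i : KIdx d ℓ hd hL b₀ b₁) (c : ↥(cubes (toKT i).D.toDomains))

/-- ★ **THE COLLAR AGREEMENT**: if `U^u = e^{iηA}` on every bond with both ends in the datum set `Q` (the (3.35) datum, gauge extended by `1` off `Q` — p33's
`exists_gauge_fld_of_reg335Cube`) and `Q` contains every torus point within `3S_j + 2` of the centre of `β`, then `U^u` and `Ṽ_□ = e^{iηχ̃_□A}` agree on every bond based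
within `3S_j + 1` (`χ̃_□ = 1` within `3.75S_j`). [cite: Balaban1985BackgroundPropagators, Cor. 3.6 p.408 («U′ = U^u = e^{iηA}»), p.410 l.14–15, p.409 l.1–3] -/
theorem collar_gaugeY_locCfgY (g : GaugeY 𝔸 i) (U : CfgY 𝔸 i) {Q : Set (Site (PV d ℓ i.m i.K hd hL) 0)} (η : ℝ) (A : AfldY 𝔸 i)
    (hQ : ∀ x : Site (PV d ℓ i.m i.K hd hL) 0, NearC i c (3 * SC i c + 2) (boxEquiv i.hN x).1 → x ∈ Q)
    (hgA : ∀ (κ : Fin (d + 1)) (x : Site (PV d ℓ i.m i.K hd hL) 0), x ∈ Q → x.shift κ ∈ Q → gaugeY i g U κ x = fluct η A κ x) :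
    ∀ (κ : Fin (d + 1)) (w : Site (PV d ℓ i.m i.K hd hL) 0), NearC i c (3 * SC i c + 1) (boxEquiv i.hN w).1 →
      gaugeY i g U κ w = locCfgY i c η A κ w := by
  intro κ w hw
  have hS := nine_le_SC i c
  have h1 : chiTY i c (boxEquiv i.hN w) = 1 := chiTY_eq_one_of_nearC i c (by omega) hw
  rw [locCfgY_apply, fluct_cutFldY_of_eq_one i η A h1]
  refine hgA κ w (hQ w (hw.mono i c (by linarith))) (hQ _ ?_)
  rw [boxEquiv_shift]
  exact nearC_shiftY i c hw κ

end Datum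

/-! ## §5 ★★★ The consumer's `hP1`, `hdef`, `hdefT` for the localised bond letter at the cut-offs of record -/

section Laws

variable (i : KIdx d ℓ hd hL b₀ b₁) (c : ↥(cubes i.D.toDomains)) (parS : SiteParY 𝔸 i)

/-- ★★★ **THE THREE PER-CUBE ALGEBRAIC INPUTS OF `…localInverseCubes''` FOR `O_□ = χ_□·R(u)⁻¹G_□(Ṽ_□)R(u)·χ_□`, GENERIC TRANSPORTER** — `hP1`, `hdef`, `hdefT` at `χ := χ_□`
(p33's `chiY i □`) and any background `V` (meant `Ṽ_□ = locCfgY i □ η A`) from: «M sufficiently large» as `2L ≤ M_h`; the gauge law of `parB`; COLLAR AGREEMENT of `U^u` and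
`V` on the bonds based within `3S_j + 1` of the centre of `β` (`hUV`; §4 for `Ṽ_□`); agreement of the `Q`-transporter tables of `parB` at `U^u`, `V` on the averaging pairs with
base point within `2S_j − 1` (`hpar`; §3 `parBY_agree_of_collar` for def-Y's taxicab transporter); and `IsUnit Δ_{a,□}(V)` (Cor 3.5's content for the cube letter — FILE G-F5,
DISPLAYED).  DEFECT LABEL: `E_□`, `E♯_□` are (R)-design terms, NOT in print; `= 0` for print's `G_□` and for r05's un-cut `GACubeY`.
[cite: Balaban1985BackgroundPropagators, Cor. 3.6 p.408 l.3–14, p.409 l.1–5, p.410 l.14–15, (3.101)∕(3.105) p.414, (3.34) p.396, (3.87) p.409] -/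
theorem localInverse_defect_laws_chiY (hM : 2 * (ℓ + 1) ≤ i.Mh) {parB : BondParY 𝔸 i} (hB : IsGaugeLawB i parB) (g : GaugeY 𝔸 i)
    (U V : CfgY 𝔸 i)
    (hUV : ∀ (κ : Fin (d + 1)) (w : Site (PV d ℓ i.m i.K hd hL) 0), NearC i c (3 * SC i c + 1) (boxEquiv i.hN w).1 → gaugeY i g U κ w = V κ w)
    (hpar : ∀ (y : IBondY i) (b : FBondY i), qK i y b ≠ 0 → (y.1.1 : ℕ) ≤ c.1.1 + 2 →
      NearC i c (2 * SC i c - 1) (boxEquiv i.hN (embIter (y.1.1 : ℕ) y.1.2.src)).1 →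
      parB (gaugeY i g U) (embIter (y.1.1 : ℕ) y.1.2.src) b.src = parB V (embIter (y.1.1 : ℕ) y.1.2.src) b.src)
    (hunit : IsUnit (deltaACubeY i c parS parB V)) :
    (locProjBY i c parS g V * cutMulY (hBdY i (hTY i c)) = cutMulY (hBdY i (hTY i c)) * locProjBY i c parS g V + locP1BY i c parS g (hTY i c) V) ∧
    cutMulY (hBdY i (hTY i c)) * (deltaLocY i parB U - locProjBY i c parS g V) * locLetterBY i c parS parB g (chiY i c) V * cutMulY (hBdY i (hTY i c)) =
        cutMulY (hBdY i (hTY i c)) * cutMulY (hBdY i (hTY i c)) - locDefectBY i c parS parB g (chiY i c) (hTY i c) V ∧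
      cutMulY (hBdY i (hTY i c)) * locLetterBY i c parS parB g (chiY i c) V * (deltaLocY i parB U - locProjBY i c parS g V) * cutMulY (hBdY i (hTY i c)) =
        cutMulY (hBdY i (hTY i c)) * cutMulY (hBdY i (hTY i c)) - locDefectTBY i c parS parB g (chiY i c) (hTY i c) V :=
  localInverse_defect_laws_hTY i c parS hB g U V (chiY i c) (DB i c)
    (fun _ hf _ hs => chiY_eq_one_of_inStencilB_hT i c hM hf hs) (fun _ _ hs h => mem_DB i c hs h) (fun _ hf => chiY_eq_one_of_mem_DB i c hM hf)
    (fun _ hf Λ => row_agree_of_hT i c hM hUV hpar hf Λ) (fun _ hf Λ => row_agree_of_mem_DB i c hM hUV hpar hf Λ) hunit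

/-- ★★★ **THE SAME AT def-Y's TAXICAB TRANSPORTER `parBY` AND THE LOCALISED FIELD `Ṽ_□ = locCfgY i □ η A`, FROM THE (3.35) DATUM**: given «`2L ≤ M_h`», a gauge `u` and field `A`
with `U^u = e^{iηA}` on the bonds of a torus set `Q ⊇ {within 3S_j + 2 of the centre of β}` (p33's `exists_gauge_fld_of_reg335Cube` from `Reg335Cube … U η Q ξ C`), and
`IsUnit Δ_{a,□}(Ṽ_□)` (FILE G-F5): the consumer's `hP1`, `hdef`, `hdefT` for `Oc □ := fun _ => locLetterBY i □ parS parBY u χ_□ Ṽ_□`.  DEFECT LABEL: `E_□`, `E♯_□` are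
(R)-design terms, NOT in print. [cite: Balaban1985BackgroundPropagators, Cor. 3.6 p.408 l.3–14, p.409 l.1–5, p.410 l.14–15, (3.101)∕(3.105) p.414, (3.40) p.397] -/
theorem localInverse_defect_laws_chiY_parBY (hM : 2 * (ℓ + 1) ≤ i.Mh) (g : GaugeY 𝔸 i) (U : CfgY 𝔸 i) {Q : Set (Site (PV d ℓ i.m i.K hd hL) 0)}
    (η : ℝ) (A : AfldY 𝔸 i)
    (hQ : ∀ x : Site (PV d ℓ i.m i.K hd hL) 0, NearC i c (3 * SC i c + 2) (boxEquiv i.hN x).1 → x ∈ Q)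
    (hgA : ∀ (κ : Fin (d + 1)) (x : Site (PV d ℓ i.m i.K hd hL) 0), x ∈ Q → x.shift κ ∈ Q → gaugeY i g U κ x = fluct η A κ x)
    (hunit : IsUnit (deltaACubeY i c parS (parBY i) (locCfgY i c η A))) :
    (locProjBY i c parS g (locCfgY i c η A) * cutMulY (hBdY i (hTY i c)) =
        cutMulY (hBdY i (hTY i c)) * locProjBY i c parS g (locCfgY i c η A) + locP1BY i c parS g (hTY i c) (locCfgY i c η A)) ∧
    cutMulY (hBdY i (hTY i c)) * (deltaLocY i (parBY i) U - locProjBY i c parS g (locCfgY i c η A)) *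
          locLetterBY i c parS (parBY i) g (chiY i c) (locCfgY i c η A) * cutMulY (hBdY i (hTY i c)) =
        cutMulY (hBdY i (hTY i c)) * cutMulY (hBdY i (hTY i c)) - locDefectBY i c parS (parBY i) g (chiY i c) (hTY i c) (locCfgY i c η A) ∧
      cutMulY (hBdY i (hTY i c)) * locLetterBY i c parS (parBY i) g (chiY i c) (locCfgY i c η A) *
          (deltaLocY i (parBY i) U - locProjBY i c parS g (locCfgY i c η A)) * cutMulY (hBdY i (hTY i c)) =
        cutMulY (hBdY i (hTY i c)) * cutMulY (hBdY i (hTY i c)) - locDefectTBY i c parS (parBY i) g (chiY i c) (hTY i c) (locCfgY i c η A) := by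
  have hUV := collar_gaugeY_locCfgY i c g U η A hQ hgA
  exact localInverse_defect_laws_chiY i c parS hM (parBY_isGaugeLawB i) g U (locCfgY i c η A) hUV
    (fun y b hb hJ hx => parBY_agree_of_collar i c hM hUV y b hb hJ hx) hunit

end Laws

end Literature.MathematicalPhysics.QuantumFieldTheory.Balaban1983to89.B9Cor36GCubeCutoffsB

end
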